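import Summits.HubbardSuperconductivity.HubbardSuperconductivity.Theorems.AnisotropyChordTransferFibre3RowCCellSound
import Summits.HubbardSuperconductivity.HubbardSuperconductivity.Theorems.AnisotropyChordTransferFibre3RowCWindow3
import Summits.HubbardSuperconductivity.HubbardSuperconductivity.Theorems.AnisotropyChordTransferFibre3ShellBulk
import Summits.HubbardSuperconductivity.HubbardSuperconductivity.Theorems.AnisotropyChordTransferFibre3ManifoldBand
import Summits.HubbardSuperconductivity.HubbardSuperconductivity.Theorems.AnisotropyChordTransferFibre3B1Instances
import Summits.HubbardSuperconductivity.HubbardSuperconductivity.Theorems.AnisotropyChordTransferFibre3RowCShellWinLemmas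
import Summits.HubbardSuperconductivity.HubbardSuperconductivity.Theorems.AnisotropyChordTransferFibre3RowCWindows64
import Summits.HubbardSuperconductivity.HubbardSuperconductivity.Theorems.AnisotropyChordTransferFibre3ManifoldA64
import Summits.HubbardSuperconductivity.HubbardSuperconductivity.Theorems.AnisotropyChordTransferFibre3RowCTCellSound

/-!
# Route `AnisotropyChord` / H0 rotor rung, row C (KT-2b) on the t-BLOCKS `64 ≤ L < 128`: block twin of `…AnisotropyChordTransferFibre3RowCShellWinLemmas`

T-FORK (p1 g32, route-lead ruling R4-b; p2's inventory memo HOME/hubbard-h0-rotor-p2/TBLOCK-INVENTORY-g8.md §3–§4): the declarations of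
`…RowCShellWinLemmas` that carry the hypothesis `128 ≤ L` (or a constant that changes below `L = 128`, or the `L2.NamedCell` cell box) restated in the
namespace `RowC.T` with the SAME names for the t-blocks (route-lead ruling R1): analytic layer with `64 ≤ L` and the `L ≥ 64` numerics of p2 g8
(`ManifoldA.nu_ceiling64` (ν < .0359), `manifold_band64`, `second_shell_window64` (±.0012/±.003), `RowC.fmax_uniform64`/`gmin_uniform64`
(same constant .07 + .1ν), `third_shell_window64` (±.0031/±.01), `window_k10_64` ([.24993, .25]), `lam_increment_bound64` (δ = .0022)); cell layer on
block cells `c : L2.TCell` (`cellFinalBoxCB (c.box a₁ a₂)`, `pmem_xTrueT`, `RowC.finalVec_mem_of_cellFinalBoxT`).  Declarations that do not change are NOT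
duplicated (they resolve to `RowC`); proofs are verbatim up to the substitutions.
Prover seat `hubbard-h0-rotor-p1` g32 (route lead); helper for piece A = stmt-HubbardSuperconductivity-23918 of rung 19089 (`--supports`, helper
class).  Nothing here proves superconductivity in the Hubbard model; lemmas for ONE row of ONE conditional reduction on the t-blocks; the rotor TARGET
as originally worded stays FALSE (g15 verdict).  Mathlib + the tree only; no sorry.
-/

set_option linter.dupNamespace false
set_option autoImplicit false

open Finset

open scoped BigOperators

namespace Summit.HubbardSuperconductivity.HubbardSuperconductivity.Theorems.AnisotropyChord.Transfer.Fibre3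

namespace RowC

namespace T

variable (L : ℕ) [NeZero L]

/-- `1/π ∈ (0.318309, 0.3183099)` re-exported in the shape used below. [folklore] -/
theorem window_k21_k30 (hL : 64 ≤ L) {Δ lam2 : ℝ} {f : Tor L → ℝ} (hΔ0 : 0 ≤ Δ) (hΔ1 : Δ < 1)
    (hf : IsGroundTwoMagnon L Δ lam2 f) :
    (0.3835 ≤ aKer L lam2 (B1.toTor L ((2 : ℤ), (1 : ℤ))) ∧ aKer L lam2 (B1.toTor L ((2 : ℤ), (1 : ℤ))) ≤ 0.3898) ∧
    (0.4202 ≤ aKer L lam2 (B1.toTor L ((3 : ℤ), (0 : ℤ))) ∧ aKer L lam2 (B1.toTor L ((3 : ℤ), (0 : ℤ))) ≤ 0.4403) := by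
  have hLpos : (0 : ℝ) < L := by exact_mod_cast (show 0 < L by omega)
  have hπ := Real.pi_pos
  set θ : ℝ := 2 * Real.pi / L with hθ
  have ht0 : 0 < θ ^ 2 := by positivity
  have hlam : 0 < lam2 := lam2_pos L (by omega) hΔ1 hf.1
  have hνc := ManifoldA.nu_ceiling64 L hL hΔ0 hf
  have hν0 : 0 ≤ lam2 / θ ^ 2 := by positivity
  have hν5 : lam2 / θ ^ 2 ≤ 0.0513 := by
    rw [div_le_iff₀ ht0, hθ]
    have hx0 : 0 ≤ (2 * Real.pi / (L : ℝ)) ^ 2 := sq_nonneg _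
    linarith [hνc]
  have hlamθ : lam2 = lam2 / θ ^ 2 * (2 * Real.pi / L) ^ 2 := by rw [hθ]; field_simp
  obtain ⟨hw21, hw30⟩ := third_shell_window64 L hL (lam2 / θ ^ 2) hν0 hν5
  rw [← hlamθ] at hw21 hw30
  have e21 : ((((2 : ℤ)) : ZMod L), (((1 : ℤ)) : ZMod L)) = B1.toTor L ((2 : ℤ), (1 : ℤ)) := rfl
  have e30 : ((((3 : ℤ)) : ZMod L), (((0 : ℤ)) : ZMod L)) = B1.toTor L ((3 : ℤ), (0 : ℤ)) := rfl
  rw [e21] at hw21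
  rw [e30] at hw30
  obtain ⟨hp1, hp2⟩ := inv_pi_bounds
  obtain ⟨hl1, hh1⟩ := abs_le.mp hw21
  obtain ⟨hl2, hh2⟩ := abs_le.mp hw30
  have e2 : 2 / Real.pi = 2 * (1 / Real.pi) := by ring
  have e12 : 12 / Real.pi = 12 * (1 / Real.pi) := by ring
  rw [e2] at hl1 hh1
  rw [e12] at hl2 hh2
  exact ⟨⟨by linarith, by linarith⟩, ⟨by linarith, by linarith⟩⟩


/-- the second-shell values on integer sites: `a_λ(1,1) ∈ [0.3171, 0.3196]`, `a_λ(2,0) ∈ [0.3603, 0.3664]`. [folklore] -/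
theorem window_k11_k20' (hL : 64 ≤ L) {Δ lam2 : ℝ} {f : Tor L → ℝ} (hΔ0 : 0 ≤ Δ) (hΔ1 : Δ < 1)
    (hf : IsGroundTwoMagnon L Δ lam2 f) :
    (0.3171 ≤ aKer L lam2 (B1.toTor L ((1 : ℤ), (1 : ℤ))) ∧ aKer L lam2 (B1.toTor L ((1 : ℤ), (1 : ℤ))) ≤ 0.3196) ∧
    (0.3603 ≤ aKer L lam2 (B1.toTor L ((2 : ℤ), (0 : ℤ))) ∧ aKer L lam2 (B1.toTor L ((2 : ℤ), (0 : ℤ))) ≤ 0.3664) := by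
  obtain ⟨⟨h1, h2⟩, ⟨h3, h4⟩⟩ := window_k11_k20 L hL hΔ0 hΔ1 hf
  have e11 : B1.toTor L ((1 : ℤ), (1 : ℤ)) = ex L + ey L := by unfold B1.toTor ex ey; ext <;> simp
  have e20 : B1.toTor L ((2 : ℤ), (0 : ℤ)) = ex L + ex L := by
    unfold B1.toTor ex; ext <;> simp
    norm_num
  rw [e11, e20]
  simp only [k11I, k20I] at h1 h2 h3 h4
  push_cast at h1 h2 h3 h4
  exact ⟨⟨by linarith, by linarith⟩, ⟨by linarith, by linarith⟩⟩


/-- ★ the window dictionary of the ground profile (`L ≥ 128`, `0 ≤ Δ < 1`): `c_s ≥ 0`, `a ≥ 0`, `f(r) = a + c_s a_λ(r)` off the origin,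
`f(K₁) = a + c_s a_λ(1,0)` and `0.115·c_s ≤ f(K₁)`. [folklore] -/
theorem window_dictionary (hL : 64 ≤ L) {Δ lam2 : ℝ} {f : Tor L → ℝ} (hΔ0 : 0 ≤ Δ) (hΔ1 : Δ < 1)
    (hf : IsGroundTwoMagnon L Δ lam2 f) :
    0 ≤ cS L Δ lam2 f ∧ 0 ≤ Δ * f (K1 L) ∧
    (∀ r : Tor L, r ≠ 0 → f r = Δ * f (K1 L) + cS L Δ lam2 f * aKer L lam2 r) ∧
    f (K1 L) = Δ * f (K1 L) + cS L Δ lam2 f * aKer L lam2 (B1.toTor L ((1 : ℤ), (0 : ℤ))) ∧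
    0.115 * cS L Δ lam2 f ≤ f (K1 L) := by
  have hL5 : 5 ≤ L := by omega
  have hL2 : 2 ≤ L := by omega
  have hLpos : (0 : ℝ) < L := by exact_mod_cast (show 0 < L by omega)
  have hL64 : (64 : ℝ) ≤ L := by exact_mod_cast hL
  have hπ := Real.pi_pos
  obtain ⟨_, hwin⟩ := ManifoldA.axis_window_closed L hL5 hΔ0 hΔ1 hf
  obtain ⟨ha0, _, _⟩ := ManifoldA.manifold_band64 L hL hΔ0 hΔ1 hf
  obtain ⟨hη, hcs, hfnn, hV⟩ := dict_N hL hΔ0 hΔ1 hf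
  set t : ℝ := (2 * Real.pi / L) ^ 2 with ht
  have ht0 : 0 < t := by positivity
  have hlam : 0 < lam2 := lam2_pos L (by omega) hΔ1 hf.1
  have hν0 : 0 < lam2 / t := div_pos hlam ht0
  have hνc : lam2 / t ≤ 0.0359 := by
    rw [div_le_iff₀ ht0, ht]; exact (ManifoldA.nu_ceiling64 L hL hΔ0 hf).le
  have htle : t ≤ 1 := by
    rw [ht, div_pow]
    rw [div_le_one (by positivity)]
    have hπ4 : Real.pi < 4 := by linarith [Real.pi_lt_d2]
    nlinarith
  set a : ℝ := Δ * f (K1 L) with ha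
  have hval : ∀ r : Tor L, r ≠ 0 → f r = a + cS L Δ lam2 f * aKer L lam2 r := by
    intro r hr
    have := hwin r hr
    linarith
  have hcs0 : 0 ≤ cS L Δ lam2 f := by
    rw [hcs]; unfold csN etaN
    have : 0 ≤ a * t / (4 * Real.pi ^ 2) := by positivity
    have : 0 ≤ Real.pi ^ 2 * (lam2 / t) := by positivity
    positivity
  refine ⟨hcs0, ha0, hval, ?_, ?_⟩
  · rw [(ex_ey_toTor L).2.2]
    exact hval _ (K1_ne_zero L hL2)
  · rw [hcs, hfnn]
    unfold csN fnnN etaN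
    have e : 0.115 * (4 * (Real.pi ^ 2 * (lam2 / t)) * (1 + a * t / (4 * Real.pi ^ 2)))
        = Real.pi ^ 2 * (lam2 / t) * 0.46 + a * (0.115 * (lam2 / t) * t) := by
      field_simp
      ring
    rw [e]
    have h1 : 0.115 * (lam2 / t) * t ≤ 1 := by nlinarith
    have h2 : 0 ≤ Real.pi ^ 2 * (lam2 / t) := by positivity
    nlinarith


end T

end RowC

end Summit.HubbardSuperconductivity.HubbardSuperconductivity.Theorems.AnisotropyChord.Transfer.Fibre3
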